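import Mathlib
import Summits.AtomisticToContinuum.HydrodynamicLimit.Theorems.ImplosionDichotomyDenseExcursionCavityUniformOuter

/-!
# The deep zone of the energy regime, I: the `u`- and `V`-rows of the resolvent system at the centre
# (crux `DenseExcursion`, line `sonic-cavity-renewal`, bricks for stub `stub_cavityResolventCk`, theorem T7(iii))

Helper file (`--supports stmt-AtomisticToContinuum-12586`, line lead a2, stub-worker E3 for `stub_cavityResolventCk`,
energy regime `Re Λ → +∞`).

**Mathematics.** In the DEEP ZONE `8‖Λ‖eˣ ≤ 1` (so `S ≥ (7/10)e^{−x} ≥ 5.6‖Λ‖ ≥ 268`) the natural unknowns are the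
centre-bounded ones, `u = ŵ` and `V = e^{2x} S ŝ` (`= σ·(eˣŝ)`, `σ = eˣS ∈ [7/10, 1]`). Solving the resolvent equations
for `(ŵ′, ŝ′)` by Cramer (`cramer_rows`, determinant `D = (W−1)² − S² ≈ −S²`) gives
* the `u`-ROW `D u′ = μ_u u − F_u` (`deep_u_row`) with `Re μ_u = (W−1)(Re Λ − β₁) + 3S(S′ + 2S) ≥ (5/2)S²` — an
  ATTRACTIVE rate `u′ ≈ −3u + …` (the regular centre behaviour `ŵ → const`, the irregular branch `e^{−3x}` being excluded by
  boundedness) — and forcing `‖F_u‖ ≤ S²(7‖Λ‖‖V‖ + (43/10)N)` (`deep_u_row_bounds`);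
* the `V`-ROW `D V′ = e^{2x}(…)` (`deep_V_row`) whose right-hand side is `O(e^{2x})`: `‖V′‖ ≤ e^{2x}(3‖Λ‖‖V‖ + ‖Λ‖‖u‖/2 + 3N)`
  (`deep_V_row_bound`) — `V` is FROZEN across the deep zone up to `O(e^{2x_d}) = O(1/‖Λ‖²)` relative errors (the regular
  perturbation of the spherical Bessel problem at `|Λ|eˣ ≤ 1/8`, no Bessel functions needed).
Sources: folklore. NOT here: the barrier/sup closure of the deep zone and the assembly (next files of worker E3).
-/

noncomputable section

open Filter Set
open scoped Topology ContDiff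

namespace Summit.AtomisticToContinuum.HydrodynamicLimit.Theorems.SonicCavityRenewal

open Summit.AtomisticToContinuum.HydrodynamicLimit.Theorems.R2OneModeTwoConditions

/-! ## Cramer's rule for the resolvent system -/

/-- **Registered helper `cramer_rows` (worker E3): CRAMER'S RULE** (pointwise algebra): the resolvent equations at `x` solved for
`ŵ′`, `ŝ′` after multiplication by the determinant `D = (W−1)² − S²` of the principal part `[[W−1, 3S],[S/3, W−1]]`. [folklore] -/
theorem cramer_rows : ∀ {r : ℝ} {W S : ℝ → ℝ} {Λ : ℂ} {ŵ ŝ f g : ℝ → ℂ} {x : ℝ}, (Λ * ŵ x - linW r W S ŵ ŝ x = f x ∧ Λ * ŝ x - linS r W S ŵ ŝ x = g x) → (((W x - 1) ^ 2 - S x ^ 2 : ℝ) : ℂ) * deriv ŵ x = ((W x - 1 : ℝ) : ℂ) * (Λ * ŵ x - ((deriv W x + 2 * W x - r : ℝ) : ℂ) * ŵ x - ((3 * deriv S x + 6 * S x : ℝ) : ℂ) * ŝ x - f x) - ((3 * S x : ℝ) : ℂ) * (Λ * ŝ x - ((deriv S x + 2 * S x : ℝ) : ℂ) * ŵ x - ((deriv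 W x / 3 + 2 * W x - r : ℝ) : ℂ) * ŝ x - g x) ∧ (((W x - 1) ^ 2 - S x ^ 2 : ℝ) : ℂ) * deriv ŝ x = ((W x - 1 : ℝ) : ℂ) * (Λ * ŝ x - ((deriv S x + 2 * S x : ℝ) : ℂ) * ŵ x - ((deriv W x / 3 + 2 * W x - r : ℝ) : ℂ) * ŝ x - g x) - ((S x / 3 : ℝ) : ℂ) * (Λ * ŵ x - ((deriv W x + 2 * W x - r : ℝ) : ℂ) * ŵ x - ((3 * deriv S x + 6 * S x : ℝ) : ℂ) * ŝ x - f x) := by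
  intro r W S Λ ŵ ŝ f g x h
  obtain ⟨h1, h2⟩ := h
  unfold linW at h1
  unfold linS at h2
  push_cast at h1 h2 ⊢
  constructor
  · linear_combination (-((W x : ℂ) - 1)) * h1 + 3 * (S x : ℂ) * h2
  · linear_combination (-((W x : ℂ) - 1)) * h2 + (S x : ℂ) / 3 * h1

/-! ## The `u`-row -/

/-- THE `u`-ROW `D u′ = μ_u u − F_u` (pointwise algebra): `μ_u = (W−1)(Λ − β₁) + 3S(S′+2S)`,
`F_u = [(W−1)(3S′+6S) + 3S(Λ − β₃)]ŝ + (W−1)f − 3Sg`, `β₁ = W′ + 2W − r`, `β₃ = W′/3 + 2W − r`. [folklore] -/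
theorem deep_u_row {r : ℝ} {W S : ℝ → ℝ} {Λ : ℂ} {ŵ ŝ f g : ℝ → ℂ} {x : ℝ}
    (h : Λ * ŵ x - linW r W S ŵ ŝ x = f x ∧ Λ * ŝ x - linS r W S ŵ ŝ x = g x) :
    (((W x - 1) ^ 2 - S x ^ 2 : ℝ) : ℂ) * deriv ŵ x =
      (((W x - 1 : ℝ) : ℂ) * (Λ - ((deriv W x + 2 * W x - r : ℝ) : ℂ)) +
          ((3 * S x * (deriv S x + 2 * S x) : ℝ) : ℂ)) * ŵ x -
        ((((W x - 1) * (3 * deriv S x + 6 * S x) : ℝ) : ℂ) * ŝ x +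
          ((3 * S x : ℝ) : ℂ) * (Λ - ((deriv W x / 3 + 2 * W x - r : ℝ) : ℂ)) * ŝ x +
          ((W x - 1 : ℝ) : ℂ) * f x - ((3 * S x : ℝ) : ℂ) * g x) := by
  obtain ⟨c1, -⟩ := cramer_rows h
  rw [c1]
  push_cast
  ring

/-- Pure real arithmetic of the `u`-rate: `(W−1)(X − β₁) + 3S(S′ + 2S) ≥ (5/2)S²` in the deep zone. [folklore] -/
theorem deep_u_rate_arith (L X Wv W' Sv S' r : ℝ) (hW : |Wv| ≤ 1 / 4) (hW' : |W'| ≤ 1 / 2) (hσ : |Sv + S'| ≤ 5 / 8)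
    (hr1 : 1 < r) (hr2 : r < 2) (hS : 268 ≤ Sv) (hX : |X| ≤ L) (hL : L ≤ Sv) :
    5 / 2 * Sv ^ 2 ≤ (Wv - 1) * (X - (W' + 2 * Wv - r)) + 3 * Sv * (S' + 2 * Sv) := by
  obtain ⟨hW₁, hW₂⟩ := abs_le.mp hW
  obtain ⟨hW₁', hW₂'⟩ := abs_le.mp hW'
  obtain ⟨hσ₁, hσ₂⟩ := abs_le.mp hσ
  obtain ⟨hX₁, hX₂⟩ := abs_le.mp hX
  have ha : |Wv - 1| ≤ 5 / 4 := abs_le.mpr ⟨by linarith, by linarith⟩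
  have hb : |X - (W' + 2 * Wv - r)| ≤ L + 3 := abs_le.mpr ⟨by linarith, by linarith⟩
  have hprod : |Wv - 1| * |X - (W' + 2 * Wv - r)| ≤ 5 / 4 * (L + 3) := mul_le_mul ha hb (abs_nonneg _) (by norm_num)
  have h1 : -(5 / 4 * (L + 3)) ≤ (Wv - 1) * (X - (W' + 2 * Wv - r)) := by
    rw [← abs_mul] at hprod
    linarith [neg_abs_le ((Wv - 1) * (X - (W' + 2 * Wv - r)))]
  have h2 : 3 * Sv * (Sv - 5 / 8) ≤ 3 * Sv * (S' + 2 * Sv) := mul_le_mul_of_nonneg_left (by linarith) (by linarith)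
  have hSv2 : 268 * Sv ≤ Sv ^ 2 := by nlinarith
  nlinarith

/-- Pure real arithmetic of the `u`-forcing: the term-by-term bounds add up to `7LS³e^{2x}‖ŝ‖ + (43/10)NS²`. [folklore] -/
theorem deep_u_forcing_arith (L Sv e ex N s : ℝ) (hS : 268 ≤ Sv) (hS7 : 7 / 10 * e ≤ Sv) (hσ7 : 7 / 10 ≤ ex * Sv)
    (hL : 48 ≤ L) (hN : 0 ≤ N) (hs : 0 ≤ s) :
    (15 / 4 * Sv + 5 / 2) * s + 3 * Sv * (L + 8 / 3) * s + 5 / 4 * N + 3 * Sv * (N * e) ≤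
      7 * L * Sv ^ 3 * ex ^ 2 * s + 43 / 10 * N * Sv ^ 2 := by
  have hSpos : 0 < Sv := by linarith
  have hSe' : Sv * e ≤ Sv * (10 / 7 * Sv) := mul_le_mul_of_nonneg_left (by linarith) hSpos.le
  have hσ2 : 49 / 100 ≤ ex ^ 2 * Sv ^ 2 := by
    have h := pow_le_pow_left₀ (by norm_num) hσ7 2
    rw [mul_pow] at h
    linarith [show ((7 : ℝ) / 10) ^ 2 = 49 / 100 by norm_num]
  have h48 : 48 * Sv ≤ L * Sv := mul_le_mul_of_nonneg_right hL hSpos.le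
  have hkey : (15 / 4 * Sv + 5 / 2) + 3 * Sv * (L + 8 / 3) ≤ 7 * L * Sv ^ 3 * ex ^ 2 := by
    have h1 : 7 * L * Sv * (49 / 100) ≤ 7 * L * Sv * (ex ^ 2 * Sv ^ 2) :=
      mul_le_mul_of_nonneg_left hσ2 (by positivity)
    have e1 : 7 * L * Sv * (ex ^ 2 * Sv ^ 2) = 7 * L * Sv ^ 3 * ex ^ 2 := by ring
    rw [e1] at h1
    linarith
  have hkey2 : 5 / 4 * N + 3 * Sv * (N * e) ≤ 43 / 10 * N * Sv ^ 2 := by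
    have h1 := mul_le_mul_of_nonneg_left hSe' (by linarith : (0 : ℝ) ≤ 3 * N)
    have h2 : N * 71824 ≤ N * Sv ^ 2 := mul_le_mul_of_nonneg_left (by nlinarith) hN
    linarith
  linarith [mul_le_mul_of_nonneg_right hkey hs]

/-- DEEP-ZONE ARITHMETIC FOR THE `u`-ROW: with `S ≥ 268`, `(7/10)e^{−x} ≤ S`, `(7/10) ≤ eˣS`, `‖Λ‖ ≤ S`,
`‖Λ‖ ≥ 48`, the tube envelope and `1 < r < 2`: `D < 0`, `−D ≤ S²`, `Re μ_u ≥ (5/2)S²` and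
`‖F_u‖ ≤ 7‖Λ‖S³e^{2x}‖ŝ‖ + (43/10)NS²` (when `‖f‖ ≤ N`, `‖g‖ ≤ Ne^{−x}`). [folklore] -/
theorem deep_u_row_bounds (Λ sv fv gv : ℂ) (r Wv W' Sv S' ex e N : ℝ) (hW : |Wv| ≤ 1 / 4) (hW' : |W'| ≤ 1 / 2)
    (hσ : |Sv + S'| ≤ 5 / 8) (hr1 : 1 < r) (hr2 : r < 2) (hS : 268 ≤ Sv) (hS7 : 7 / 10 * e ≤ Sv)
    (hσ7 : 7 / 10 ≤ ex * Sv) (hΛS : ‖Λ‖ ≤ Sv) (hΛ : 48 ≤ ‖Λ‖) (hN : 0 ≤ N) (hf : ‖fv‖ ≤ N) (hg : ‖gv‖ ≤ N * e) :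
    (Wv - 1) ^ 2 - Sv ^ 2 < 0 ∧ -((Wv - 1) ^ 2 - Sv ^ 2) ≤ Sv ^ 2 ∧
    5 / 2 * Sv ^ 2 ≤ (((Wv - 1 : ℝ) : ℂ) * (Λ - ((W' + 2 * Wv - r : ℝ) : ℂ)) +
        ((3 * Sv * (S' + 2 * Sv) : ℝ) : ℂ)).re ∧
    ‖(((Wv - 1) * (3 * S' + 6 * Sv) : ℝ) : ℂ) * sv + ((3 * Sv : ℝ) : ℂ) * (Λ - ((W' / 3 + 2 * Wv - r : ℝ) : ℂ)) * sv +
        ((Wv - 1 : ℝ) : ℂ) * fv - ((3 * Sv : ℝ) : ℂ) * gv‖ ≤ 7 * ‖Λ‖ * Sv ^ 3 * ex ^ 2 * ‖sv‖ + 43 / 10 * N * Sv ^ 2 := by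
  obtain ⟨hW₁, hW₂⟩ := abs_le.mp hW
  obtain ⟨hW₁', hW₂'⟩ := abs_le.mp hW'
  obtain ⟨hσ₁, hσ₂⟩ := abs_le.mp hσ
  have hSpos : 0 < Sv := by linarith
  have hWsq : (Wv - 1) ^ 2 ≤ 25 / 16 := by nlinarith
  have hD : (Wv - 1) ^ 2 - Sv ^ 2 < 0 := by nlinarith
  refine ⟨hD, by linarith [sq_nonneg (Wv - 1)], ?_, ?_⟩
  · -- the rate
    have hre : |Λ.re| ≤ ‖Λ‖ := Complex.abs_re_le_norm Λ
    have key := deep_u_rate_arith ‖Λ‖ Λ.re Wv W' Sv S' r hW hW' hσ hr1 hr2 hS hre hΛS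
    simp only [Complex.add_re, Complex.mul_re, Complex.ofReal_re, Complex.ofReal_im, Complex.sub_re, Complex.sub_im,
      zero_mul, sub_zero]
    exact key
  · -- the forcing, term by term
    have hs0 : 0 ≤ ‖sv‖ := norm_nonneg _
    have ha : |Wv - 1| ≤ 5 / 4 := abs_le.mpr ⟨by linarith, by linarith⟩
    have hc1 : |(Wv - 1) * (3 * S' + 6 * Sv)| ≤ 15 / 4 * Sv + 5 / 2 := by
      rw [abs_mul]
      have hb : |3 * S' + 6 * Sv| ≤ 3 * Sv + 2 := abs_le.mpr ⟨by linarith, by linarith⟩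
      calc |Wv - 1| * |3 * S' + 6 * Sv| ≤ 5 / 4 * (3 * Sv + 2) := mul_le_mul ha hb (abs_nonneg _) (by norm_num)
        _ = 15 / 4 * Sv + 5 / 2 := by ring
    have hΛb : ‖Λ - ((W' / 3 + 2 * Wv - r : ℝ) : ℂ)‖ ≤ ‖Λ‖ + 8 / 3 :=
      calc ‖Λ - ((W' / 3 + 2 * Wv - r : ℝ) : ℂ)‖ ≤ ‖Λ‖ + ‖((W' / 3 + 2 * Wv - r : ℝ) : ℂ)‖ := norm_sub_le _ _
        _ ≤ ‖Λ‖ + 8 / 3 := by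
          rw [Complex.norm_real, Real.norm_eq_abs]
          have : |W' / 3 + 2 * Wv - r| ≤ 8 / 3 := abs_le.mpr ⟨by linarith, by linarith⟩
          linarith
    have t1 : ‖(((Wv - 1) * (3 * S' + 6 * Sv) : ℝ) : ℂ) * sv‖ ≤ (15 / 4 * Sv + 5 / 2) * ‖sv‖ := by
      rw [norm_mul, Complex.norm_real, Real.norm_eq_abs]; exact mul_le_mul_of_nonneg_right hc1 hs0
    have t2 : ‖((3 * Sv : ℝ) : ℂ) * (Λ - ((W' / 3 + 2 * Wv - r : ℝ) : ℂ)) * sv‖ ≤ 3 * Sv * (‖Λ‖ + 8 / 3) * ‖sv‖ := by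
      rw [norm_mul, norm_mul, Complex.norm_real, Real.norm_eq_abs, abs_of_pos (by linarith : (0 : ℝ) < 3 * Sv)]
      exact mul_le_mul_of_nonneg_right (mul_le_mul_of_nonneg_left hΛb (by linarith)) hs0
    have t3 : ‖((Wv - 1 : ℝ) : ℂ) * fv‖ ≤ 5 / 4 * N := by
      rw [norm_mul, Complex.norm_real, Real.norm_eq_abs]
      exact mul_le_mul ha hf (norm_nonneg _) (by norm_num)
    have t4 : ‖((3 * Sv : ℝ) : ℂ) * gv‖ ≤ 3 * Sv * (N * e) := by
      rw [norm_mul, Complex.norm_real, Real.norm_eq_abs, abs_of_pos (by linarith : (0 : ℝ) < 3 * Sv)]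
      exact mul_le_mul_of_nonneg_left hg (by linarith)
    have hsum : ‖(((Wv - 1) * (3 * S' + 6 * Sv) : ℝ) : ℂ) * sv +
        ((3 * Sv : ℝ) : ℂ) * (Λ - ((W' / 3 + 2 * Wv - r : ℝ) : ℂ)) * sv + ((Wv - 1 : ℝ) : ℂ) * fv -
        ((3 * Sv : ℝ) : ℂ) * gv‖ ≤ (15 / 4 * Sv + 5 / 2) * ‖sv‖ + 3 * Sv * (‖Λ‖ + 8 / 3) * ‖sv‖ + 5 / 4 * N +
        3 * Sv * (N * e) := by
      refine (norm_sub_le _ _).trans ?_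
      refine (add_le_add ((norm_add_le _ _).trans (add_le_add (norm_add_le _ _) le_rfl)) le_rfl).trans ?_
      linarith
    exact hsum.trans (deep_u_forcing_arith ‖Λ‖ Sv e ex N ‖sv‖ hS hS7 hσ7 hΛ hN hs0)

/-! ## The `V`-row -/

/-- THE `V`-ROW (pointwise algebra): for `V = e^{2x}Sŝ`, `D·V′ = e^{2x}{(W−1)[(W−1)(2S+S′) + S(Λ−β₃)]ŝ − S[(W−1)(S′+2S) +
(S/3)(Λ−β₁)]ŵ − S(W−1)g + (S²/3)f}` where `V′ = e^{2x}(2S + S′)ŝ + e^{2x}Sŝ′`. [folklore] -/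
theorem deep_V_row {r : ℝ} {W S : ℝ → ℝ} {Λ : ℂ} {ŵ ŝ f g : ℝ → ℂ} {x : ℝ}
    (h : Λ * ŵ x - linW r W S ŵ ŝ x = f x ∧ Λ * ŝ x - linS r W S ŵ ŝ x = g x) :
    (((W x - 1) ^ 2 - S x ^ 2 : ℝ) : ℂ) *
        (((Real.exp (2 * x) * (2 * S x + deriv S x) : ℝ) : ℂ) * ŝ x +
          ((Real.exp (2 * x) * S x : ℝ) : ℂ) * deriv ŝ x) =
      ((Real.exp (2 * x) : ℝ) : ℂ) *
        ((((W x - 1) * ((W x - 1) * (2 * S x + deriv S x)) : ℝ) : ℂ) * ŝ x +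
          (((W x - 1) * S x : ℝ) : ℂ) * (Λ - ((deriv W x / 3 + 2 * W x - r : ℝ) : ℂ)) * ŝ x -
          ((S x * ((W x - 1) * (deriv S x + 2 * S x)) : ℝ) : ℂ) * ŵ x -
          ((S x * (S x / 3) : ℝ) : ℂ) * (Λ - ((deriv W x + 2 * W x - r : ℝ) : ℂ)) * ŵ x -
          ((S x * (W x - 1) : ℝ) : ℂ) * g x + ((S x ^ 2 / 3 : ℝ) : ℂ) * f x) := by
  obtain ⟨-, c2⟩ := cramer_rows h
  have e : (((W x - 1) ^ 2 - S x ^ 2 : ℝ) : ℂ) *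
        (((Real.exp (2 * x) * (2 * S x + deriv S x) : ℝ) : ℂ) * ŝ x +
          ((Real.exp (2 * x) * S x : ℝ) : ℂ) * deriv ŝ x) =
      (((W x - 1) ^ 2 - S x ^ 2 : ℝ) : ℂ) * ((Real.exp (2 * x) * (2 * S x + deriv S x) : ℝ) : ℂ) * ŝ x +
        ((Real.exp (2 * x) * S x : ℝ) : ℂ) * ((((W x - 1) ^ 2 - S x ^ 2 : ℝ) : ℂ) * deriv ŝ x) := by ring
  rw [e, c2]
  push_cast
  ring

/-- Pure real arithmetic of the `V`-row: the six term bounds against `|D| ≥ 0.9999 S²`. [folklore] -/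
theorem deep_V_arith (L Sv e E2 N s u Vn Dabs : ℝ) (hS : 268 ≤ Sv) (hS7 : 7 / 10 * e ≤ Sv)
    (hσ2 : 49 / 100 ≤ E2 * Sv ^ 2) (hE2 : 0 < E2) (hL : 48 ≤ L) (hN : 0 ≤ N) (hs : 0 ≤ s) (hu : 0 ≤ u)
    (hD : 9999 / 10000 * Sv ^ 2 ≤ Dabs)
    (hmain : Dabs * Vn ≤ E2 * (25 / 16 * (Sv + 5 / 8) * s + 5 / 4 * Sv * (L + 8 / 3) * s +
      Sv * (5 / 4 * (Sv + 5 / 8)) * u + Sv * (Sv / 3) * (L + 3) * u + Sv * (5 / 4) * (N * e) + Sv ^ 2 / 3 * N)) :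
    Dabs * Vn ≤ Dabs * (E2 * (3 * L * (E2 * Sv * s) + L / 2 * u + 3 * N)) := by
  have hSpos : 0 < Sv := by linarith
  have hSe' : Sv * e ≤ Sv * (10 / 7 * Sv) := mul_le_mul_of_nonneg_left (by linarith) hSpos.le
  have hSv2 : 268 * Sv ≤ Sv ^ 2 := by nlinarith
  have h48 : 48 * Sv ≤ L * Sv := mul_le_mul_of_nonneg_right hL hSpos.le
  have h48' : 48 * Sv ^ 2 ≤ L * Sv ^ 2 := mul_le_mul_of_nonneg_right hL (sq_nonneg _)
  have g1 : 25 / 16 * (Sv + 5 / 8) + 5 / 4 * Sv * (L + 8 / 3) ≤ 9999 / 10000 * Sv ^ 2 * (3 * L * (E2 * Sv)) := by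
    have h1 : 9999 / 10000 * (3 * L) * Sv * (49 / 100) ≤ 9999 / 10000 * (3 * L) * Sv * (E2 * Sv ^ 2) :=
      mul_le_mul_of_nonneg_left hσ2 (by positivity)
    have e1 : 9999 / 10000 * (3 * L) * Sv * (E2 * Sv ^ 2) = 9999 / 10000 * Sv ^ 2 * (3 * L * (E2 * Sv)) := by ring
    rw [e1] at h1
    linarith
  have g2 : Sv * (5 / 4 * (Sv + 5 / 8)) + Sv * (Sv / 3) * (L + 3) ≤ 9999 / 10000 * Sv ^ 2 * (L / 2) := by
    linarith
  have g3 : Sv * (5 / 4) * (N * e) + Sv ^ 2 / 3 * N ≤ 9999 / 10000 * Sv ^ 2 * (3 * N) := by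
    have h1 := mul_le_mul_of_nonneg_left hSe' (by linarith : (0 : ℝ) ≤ 5 / 4 * N)
    have h2 : 0 ≤ N * Sv ^ 2 := by positivity
    linarith
  have k1 := mul_le_mul_of_nonneg_right g1 hs
  have k2 := mul_le_mul_of_nonneg_right g2 hu
  have hsum : 25 / 16 * (Sv + 5 / 8) * s + 5 / 4 * Sv * (L + 8 / 3) * s + Sv * (5 / 4 * (Sv + 5 / 8)) * u +
      Sv * (Sv / 3) * (L + 3) * u + Sv * (5 / 4) * (N * e) + Sv ^ 2 / 3 * N ≤
      9999 / 10000 * Sv ^ 2 * (3 * L * (E2 * Sv * s) + L / 2 * u + 3 * N) := by linarith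
  have k3 := mul_le_mul_of_nonneg_left hsum hE2.le
  have k4 := mul_le_mul_of_nonneg_right hD (by positivity : (0 : ℝ) ≤ E2 * (3 * L * (E2 * Sv * s) + L / 2 * u + 3 * N))
  calc Dabs * Vn ≤ _ := hmain
    _ ≤ E2 * (9999 / 10000 * Sv ^ 2 * (3 * L * (E2 * Sv * s) + L / 2 * u + 3 * N)) := k3
    _ = 9999 / 10000 * Sv ^ 2 * (E2 * (3 * L * (E2 * Sv * s) + L / 2 * u + 3 * N)) := by ring
    _ ≤ Dabs * (E2 * (3 * L * (E2 * Sv * s) + L / 2 * u + 3 * N)) := k4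

/-- DEEP-ZONE ARITHMETIC FOR THE `V`-ROW: under the deep-zone facts, `|D|·‖V′‖ = e^{2x}‖…‖` gives
`‖V′‖ ≤ e^{2x}(3‖Λ‖(e^{2x}S‖ŝ‖) + ‖Λ‖‖ŵ‖/2 + 3N)` (note `e^{2x}S‖ŝ‖ = ‖V‖`). Stated for abstract values: `V′` is any complex
number with `D V′ = e^{2x}·R`. [folklore] -/
theorem deep_V_row_bound (Λ sv uv fv gv V' : ℂ) (r Wv W' Sv S' e E2 N : ℝ) (hW : |Wv| ≤ 1 / 4)
    (hW' : |W'| ≤ 1 / 2) (hσ : |Sv + S'| ≤ 5 / 8) (hr1 : 1 < r) (hr2 : r < 2) (hS : 268 ≤ Sv) (hS7 : 7 / 10 * e ≤ Sv)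
    (hσ2 : 49 / 100 ≤ E2 * Sv ^ 2) (hE2 : 0 < E2) (hΛ : 48 ≤ ‖Λ‖) (hN : 0 ≤ N) (hf : ‖fv‖ ≤ N)
    (hg : ‖gv‖ ≤ N * e)
    (heq : (((Wv - 1) ^ 2 - Sv ^ 2 : ℝ) : ℂ) * V' = ((E2 : ℝ) : ℂ) *
      ((((Wv - 1) * ((Wv - 1) * (2 * Sv + S')) : ℝ) : ℂ) * sv +
        (((Wv - 1) * Sv : ℝ) : ℂ) * (Λ - ((W' / 3 + 2 * Wv - r : ℝ) : ℂ)) * sv -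
        ((Sv * ((Wv - 1) * (S' + 2 * Sv)) : ℝ) : ℂ) * uv -
        ((Sv * (Sv / 3) : ℝ) : ℂ) * (Λ - ((W' + 2 * Wv - r : ℝ) : ℂ)) * uv -
        ((Sv * (Wv - 1) : ℝ) : ℂ) * gv + ((Sv ^ 2 / 3 : ℝ) : ℂ) * fv)) :
    ‖V'‖ ≤ E2 * (3 * ‖Λ‖ * (E2 * Sv * ‖sv‖) + ‖Λ‖ / 2 * ‖uv‖ + 3 * N) := by
  obtain ⟨hW₁, hW₂⟩ := abs_le.mp hW
  obtain ⟨hW₁', hW₂'⟩ := abs_le.mp hW'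
  obtain ⟨hσ₁, hσ₂⟩ := abs_le.mp hσ
  have hSpos : 0 < Sv := by linarith
  have hWsq : (Wv - 1) ^ 2 ≤ 25 / 16 := by nlinarith
  have hD : (Wv - 1) ^ 2 - Sv ^ 2 < 0 := by nlinarith
  have hDabs : 9999 / 10000 * Sv ^ 2 ≤ |(Wv - 1) ^ 2 - Sv ^ 2| := by
    rw [abs_of_neg hD]; nlinarith
  -- norms of the right-hand side terms
  have hs0 : 0 ≤ ‖sv‖ := norm_nonneg _
  have hu0 : 0 ≤ ‖uv‖ := norm_nonneg _
  have ha : |Wv - 1| ≤ 5 / 4 := abs_le.mpr ⟨by linarith, by linarith⟩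
  have hΛ3 : ‖Λ - ((W' / 3 + 2 * Wv - r : ℝ) : ℂ)‖ ≤ ‖Λ‖ + 8 / 3 :=
    calc ‖Λ - ((W' / 3 + 2 * Wv - r : ℝ) : ℂ)‖ ≤ ‖Λ‖ + ‖((W' / 3 + 2 * Wv - r : ℝ) : ℂ)‖ := norm_sub_le _ _
      _ ≤ ‖Λ‖ + 8 / 3 := by
        rw [Complex.norm_real, Real.norm_eq_abs]
        have : |W' / 3 + 2 * Wv - r| ≤ 8 / 3 := abs_le.mpr ⟨by linarith, by linarith⟩
        linarith
  have hΛ1 : ‖Λ - ((W' + 2 * Wv - r : ℝ) : ℂ)‖ ≤ ‖Λ‖ + 3 :=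
    calc ‖Λ - ((W' + 2 * Wv - r : ℝ) : ℂ)‖ ≤ ‖Λ‖ + ‖((W' + 2 * Wv - r : ℝ) : ℂ)‖ := norm_sub_le _ _
      _ ≤ ‖Λ‖ + 3 := by
        rw [Complex.norm_real, Real.norm_eq_abs]
        have : |W' + 2 * Wv - r| ≤ 3 := abs_le.mpr ⟨by linarith, by linarith⟩
        linarith
  have t1 : ‖(((Wv - 1) * ((Wv - 1) * (2 * Sv + S')) : ℝ) : ℂ) * sv‖ ≤ 25 / 16 * (Sv + 5 / 8) * ‖sv‖ := by
    rw [norm_mul, Complex.norm_real, Real.norm_eq_abs]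
    refine mul_le_mul_of_nonneg_right ?_ hs0
    rw [abs_mul, abs_mul]
    have hb : |2 * Sv + S'| ≤ Sv + 5 / 8 := abs_le.mpr ⟨by linarith, by linarith⟩
    calc |Wv - 1| * (|Wv - 1| * |2 * Sv + S'|) ≤ 5 / 4 * (5 / 4 * (Sv + 5 / 8)) :=
          mul_le_mul ha (mul_le_mul ha hb (abs_nonneg _) (by norm_num)) (by positivity) (by norm_num)
      _ = 25 / 16 * (Sv + 5 / 8) := by ring
  have t2 : ‖(((Wv - 1) * Sv : ℝ) : ℂ) * (Λ - ((W' / 3 + 2 * Wv - r : ℝ) : ℂ)) * sv‖ ≤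
      5 / 4 * Sv * (‖Λ‖ + 8 / 3) * ‖sv‖ := by
    rw [norm_mul, norm_mul, Complex.norm_real, Real.norm_eq_abs, abs_mul, abs_of_pos hSpos]
    refine mul_le_mul_of_nonneg_right ?_ hs0
    exact mul_le_mul (mul_le_mul_of_nonneg_right ha hSpos.le) hΛ3 (norm_nonneg _) (by positivity)
  have t3 : ‖((Sv * ((Wv - 1) * (S' + 2 * Sv)) : ℝ) : ℂ) * uv‖ ≤ Sv * (5 / 4 * (Sv + 5 / 8)) * ‖uv‖ := by
    rw [norm_mul, Complex.norm_real, Real.norm_eq_abs, abs_mul, abs_mul, abs_of_pos hSpos]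
    have hb : |S' + 2 * Sv| ≤ Sv + 5 / 8 := abs_le.mpr ⟨by linarith, by linarith⟩
    refine mul_le_mul_of_nonneg_right ?_ hu0
    exact mul_le_mul_of_nonneg_left (mul_le_mul ha hb (abs_nonneg _) (by norm_num)) hSpos.le
  have t4 : ‖((Sv * (Sv / 3) : ℝ) : ℂ) * (Λ - ((W' + 2 * Wv - r : ℝ) : ℂ)) * uv‖ ≤
      Sv * (Sv / 3) * (‖Λ‖ + 3) * ‖uv‖ := by
    rw [norm_mul, norm_mul, Complex.norm_real, Real.norm_eq_abs, abs_of_pos (by positivity)]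
    refine mul_le_mul_of_nonneg_right ?_ hu0
    exact mul_le_mul_of_nonneg_left hΛ1 (by positivity)
  have t5 : ‖((Sv * (Wv - 1) : ℝ) : ℂ) * gv‖ ≤ Sv * (5 / 4) * (N * e) := by
    rw [norm_mul, Complex.norm_real, Real.norm_eq_abs, abs_mul, abs_of_pos hSpos]
    exact mul_le_mul (mul_le_mul_of_nonneg_left ha hSpos.le) hg (norm_nonneg _) (by positivity)
  have t6 : ‖((Sv ^ 2 / 3 : ℝ) : ℂ) * fv‖ ≤ Sv ^ 2 / 3 * N := by
    rw [norm_mul, Complex.norm_real, Real.norm_eq_abs, abs_of_pos (by positivity)]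
    exact mul_le_mul_of_nonneg_left hf (by positivity)
  have hR : ‖(((Wv - 1) * ((Wv - 1) * (2 * Sv + S')) : ℝ) : ℂ) * sv +
        (((Wv - 1) * Sv : ℝ) : ℂ) * (Λ - ((W' / 3 + 2 * Wv - r : ℝ) : ℂ)) * sv -
        ((Sv * ((Wv - 1) * (S' + 2 * Sv)) : ℝ) : ℂ) * uv -
        ((Sv * (Sv / 3) : ℝ) : ℂ) * (Λ - ((W' + 2 * Wv - r : ℝ) : ℂ)) * uv -
        ((Sv * (Wv - 1) : ℝ) : ℂ) * gv + ((Sv ^ 2 / 3 : ℝ) : ℂ) * fv‖ ≤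
      25 / 16 * (Sv + 5 / 8) * ‖sv‖ + 5 / 4 * Sv * (‖Λ‖ + 8 / 3) * ‖sv‖ + Sv * (5 / 4 * (Sv + 5 / 8)) * ‖uv‖ +
        Sv * (Sv / 3) * (‖Λ‖ + 3) * ‖uv‖ + Sv * (5 / 4) * (N * e) + Sv ^ 2 / 3 * N := by
    refine (norm_add_le _ _).trans ?_
    refine (add_le_add ((norm_sub_le _ _).trans (add_le_add ((norm_sub_le _ _).trans (add_le_add
      ((norm_sub_le _ _).trans (add_le_add (norm_add_le _ _) le_rfl)) le_rfl)) le_rfl)) le_rfl).trans ?_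
    linarith
  -- `|D| ‖V′‖ = E2 ‖R‖`
  have hn : |(Wv - 1) ^ 2 - Sv ^ 2| * ‖V'‖ = E2 * ‖(((Wv - 1) * ((Wv - 1) * (2 * Sv + S')) : ℝ) : ℂ) * sv +
        (((Wv - 1) * Sv : ℝ) : ℂ) * (Λ - ((W' / 3 + 2 * Wv - r : ℝ) : ℂ)) * sv -
        ((Sv * ((Wv - 1) * (S' + 2 * Sv)) : ℝ) : ℂ) * uv -
        ((Sv * (Sv / 3) : ℝ) : ℂ) * (Λ - ((W' + 2 * Wv - r : ℝ) : ℂ)) * uv -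
        ((Sv * (Wv - 1) : ℝ) : ℂ) * gv + ((Sv ^ 2 / 3 : ℝ) : ℂ) * fv‖ := by
    have := congrArg (fun z : ℂ => ‖z‖) heq
    simp only [norm_mul, Complex.norm_real, Real.norm_eq_abs, abs_of_pos hE2] at this
    exact this
  have hmain := hn.le.trans (mul_le_mul_of_nonneg_left hR hE2.le)
  have key := deep_V_arith ‖Λ‖ Sv e E2 N ‖sv‖ ‖uv‖ ‖V'‖ _ hS hS7 hσ2 hE2 hΛ hN hs0 hu0 hDabs hmain
  exact le_of_mul_le_mul_left key (abs_pos.mpr hD.ne)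

end Summit.AtomisticToContinuum.HydrodynamicLimit.Theorems.SonicCavityRenewal

end
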